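import Literature.Geometry.Lorentzian.MassCapacityExpansion
import Literature.Geometry.Lorentzian.HopfPositivity
import Literature.Geometry.Lorentzian.DalembertianNaturality
import Literature.Geometry.Lorentzian.DalembertianCompose
import Literature.Geometry.Lorentzian.IsometryProofs
import Literature.Geometry.Lorentzian.AFLinearUniqueness
import Literature.Geometry.Manifold.OpenSubmanifoldMFDeriv
import HarnessLib

/-!
# The capacity potential of a horizon: maximum principle, `0 < φ < 1`, uniqueness
# (Bray 2001, §6, the Green's function (86))

Companion of `MassCapacity.lean` / `MassCapacityProofs.lean` / `MassCapacityHarmonic.lean` /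
`MassCapacityExpansion.lean` on the discharge path of the named fact
`Bray2001_mass_ge_half_capacity` (Bray, J. Differential Geom. 59 (2001), Thm. 9:
`m ≥ ½ ℰ(Σ, g)`). The capacity `ℰ(Σ, g)` of Def. 17 (`horizonCapacity`) enters the mass through
*"the Green's function `φ(x)` which satisfies (86): `lim_{x→∞} φ = 1`, `Δφ = 0`, `φ = 0` on `Σ`"*
— the definite article, the normalisation `0 < φ < 1` used throughout §6 (e.g. in the level-set
formulas and in "from symmetry, `φ(x) = ½(ϕ(x) + 1)`", (92), on the doubled manifold), and the
identification `ℰ(ḡ) = ½ ℰ(Σ, g)` (93) all rest on the **maximum principle** for harmonic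
functions on the exterior region, with boundary values on `Σ` and at infinity. This file proves
that maximum principle for the tree's intrinsic Laplace–Beltrami operator
(`PseudoRiemannianMetric.dalembertian = tr_h Hess`) and draws the consequences; in particular the
hypothesis `0 < φ₀ < 1` of the capacity theorems of `MassCapacityHarmonic.lean` /
`MassCapacityExpansion.lean` is removed.

* `PseudoRiemannianMetric.dalembertian_supersolution_eqOn_of_isPreconnected` — **E. Hopf's
  strong minimum principle with local hypotheses** (López-Gómez 2012, Thm. 1.2; Gilbarg–Trudinger,
  Thm. 3.5): on a preconnected open subset `V` of a Riemannian manifold modelled on `ℝᴺ`, a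
  function `φ ∈ C²(V)` with `Δ_g φ ≤ c φ` (`c ≥ 0` continuous on `V`), `φ ≥ m` on `V` for a
  constant `m ≤ 0`, and `φ(x₀) = m` at some `x₀ ∈ V`, is `≡ m` on `V`. (The global form of
  `HopfPositivity.lean` applied on the open submanifold `V` with the restricted metric `ι^* g`,
  `PseudoRiemannianMetric.comap` along the inclusion `ι`, whose Laplacian is that of `g` by the
  naturality `dalembertian_comap` of `DalembertianNaturality.lean`.)
* `IsExteriorRegion.nonneg_of_dalembertian_le` (`_nonpos`) — **minimum principle on an exterior
  region** `U` of an end `e` (connected, compact modulo the end): a function continuous on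
  `closure U`, `C²` with `Δ_h u ≤ c u` on `U` (`c ≥ 0` continuous; `c = 0`: superharmonic), `≥ 0`
  on `Σ = ∂U` and with `liminf ≥ 0` at infinity in the end, is `≥ 0` on `U` (a negative value
  would produce a negative interior minimum over the compact `closure U ∖ far R`, hence a negative
  constant on `U`, impossible far out); `IsExteriorRegion.eqOn_of_dalembertian_eq` — uniqueness
  for the exterior Dirichlet problem (same Laplacian on `U`, same values on `Σ`, same limit at
  infinity ⇒ equal on `U`).
* For a test function `φ₀` of the capacity (`IsCapacityTestFn`: continuous, smooth on `U`, `0` on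
  `Σ` and inside, `→ 1` at infinity) which is `h`-harmonic on `U`:
  `IsCapacityTestFn.nonneg_of_harmonic`, `le_one_of_harmonic` (`0 ≤ φ₀ ≤ 1` on `X`),
  `pos_of_harmonic` (`φ₀ > 0` on `U`), `lt_one_of_harmonic` (`φ₀ < 1` on `U` when `Σ ≠ ∅`),
  `eq_one_of_harmonic_of_frontier_eq_empty` (`φ₀ ≡ 1` on `U` when `Σ = ∅`), and
  **uniqueness** `IsCapacityTestFn.eq_of_harmonic`: two harmonic test functions coincide (Bray's
  "the" Green's function; no energy or decay hypothesis is needed).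
* The capacity theorems without sign hypotheses: `horizonCapacity_eq_of_harmonic'`
  (`ℰ(Σ, g) = (1/2π) ∫_U |∇φ₀|²`), `setLIntegral_gradNorm_sq_le_dirichletEnergy_of_harmonic'`
  (Dirichlet principle), `horizonCapacity_toReal_eq_of_harmonic'`,
  `setIntegral_gradNorm_sq_eq_of_harmonic_of_expansion'` (`∫_U |∇φ₀|² = 4πc` for
  `φ₀ ∘ Φ = 1 − c/r + O₁(r⁻²)`), `horizonCapacity_eq_ofReal_of_harmonic_of_expansion'`
  (`ℰ = 2c`, Bray's (87)), `horizonCapacity_toReal_div_two_eq_of_harmonic_of_expansion'` and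
  `IsOutsideOf.horizonCapacity_toReal_div_two_eq'` (`½ ℰ = c ≥ 0` under the hypotheses of the
  fact). For the empty horizon (`frontier U = ∅`) `φ₀ ≡ 1` on `U`, both sides of the capacity
  identity vanish, and an expansion `1 − c/r + O₁(r⁻²)` forces `c = 0`
  (`eq_zero_of_expansion_of_eqOn_far`).

Everything is proved; there are no definitions and no named facts. Auxiliary: `endValue_sub`,
`TendstoAtEnd.sub`, `TendstoAtEnd.exists_radius_lt` (levels below the limit are exceeded far
out), `dalembertian_affine_apply` (`Δ_h (a f + b) = a Δ_h f`).

## References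

* H. L. Bray, *Proof of the Riemannian Penrose inequality using the positive mass theorem*,
  J. Differential Geom. 59 (2001) 177–267 (arXiv:math/9911173), §6: Def. 16–17, the Green's
  function (86)–(87), (92)–(93), Thm. 9 (key `BrayRPI2001`).
* J. López-Gómez, *Linear Second Order Elliptic Operators*, World Scientific (2012; © 2013),
  Ch. 1, Thm. 1.2 (minimum principle of E. Hopf) (key `LopezGomez2012`).
* D. Gilbarg, N. S. Trudinger, *Elliptic Partial Differential Equations of Second Order*,
  Springer 2001, Thm. 3.5 (strong maximum principle) (key `GilbargTrudinger2001`).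
* B. O'Neill, *Semi-Riemannian geometry*, Academic Press 1983, Ch. 3, Prop. 3.59 and pp. 90–91
  (local isometries preserve the Laplacian) (key `ONeill1983`).
-/

noncomputable section

open Bundle Set Function Manifold TopologicalSpace Filter MeasureTheory
open scoped ContDiff Topology Manifold Real

namespace Literature.Geometry.Lorentzian

/-! ## E. Hopf's minimum principle on a preconnected open subset -/

namespace PseudoRiemannianMetric

variable {N : ℕ} {M : Type*} [TopologicalSpace M] [ChartedSpace (EuclideanSpace ℝ (Fin N)) M]
  [IsManifold (𝓡 N) ∞ M]
  (g : PseudoRiemannianMetric (𝓡 N) ∞ (EuclideanSpace ℝ (Fin N)) (TangentSpace (𝓡 N) : M → Type _))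
  [g.HasLeviCivita]

/-- **E. Hopf's strong minimum principle for `−Δ_g + c` with local hypotheses, on a preconnected
open set** (López-Gómez 2012, Thm. 1.2; Gilbarg–Trudinger 2001, Thm. 3.5). Let `g` be a smooth
Riemannian metric on a manifold `M` modelled on `ℝᴺ` and `V ⊆ M` open and preconnected; let
`c ≥ 0` be continuous on `V` and `φ` of class `C²` on `V` with `Δ_g φ ≤ c φ` on `V`
(`Δ_g = tr_g Hess`, the prelude's `dalembertian`). If `φ ≥ m` on `V` for a constant `m ≤ 0` and
`φ(x₀) = m` at a point `x₀ ∈ V`, then `φ ≡ m` on `V`. Proof: the open submanifold `V` (Mathlib's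
`TopologicalSpace.Opens` charted-space structure) carries the restricted metric `ι^* g`
(`PseudoRiemannianMetric.comap` along the inclusion `ι : V → M`, an injective-differential
immersion, `OpenSubmanifold.mfderiv_subtype_val`), which is Riemannian with
`Δ_{ι^* g}(φ ∘ ι) = (Δ_g φ) ∘ ι` (`dalembertian_comap`); on the preconnected manifold `V` the
global form `dalembertian_supersolution_eq_of_exists_eq` (`HopfPositivity.lean`) applies.
[cite: LopezGomez2012, Thm. 1.2] [cite: GilbargTrudinger2001, Thm. 3.5] -/
theorem dalembertian_supersolution_eqOn_of_isPreconnected (hg : g.IsRiemannian) {V : Opens M}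
    (hV : IsPreconnected (V : Set M)) {c φ : M → ℝ} (hc : ContinuousOn c V)
    (hc0 : ∀ x ∈ V, 0 ≤ c x) (hφ : ContMDiffOn (𝓡 N) 𝓘(ℝ) 2 φ V)
    (hpde : ∀ x ∈ V, g.dalembertian φ x ≤ c x * φ x) {m : ℝ} (hm : m ≤ 0)
    (hmin : ∀ x ∈ V, m ≤ φ x) {x₀ : M} (hx₀V : x₀ ∈ V) (hx₀ : φ x₀ = m) :
    ∀ x ∈ V, φ x = m := by
  -- the open submanifold `V` with the restricted metric `ι^* g`, `ι : V → M` the inclusion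
  haveI : PreconnectedSpace V := Subtype.preconnectedSpace hV
  have hι : ContMDiff (𝓡 N) (𝓡 N) (∞ + 1) (Subtype.val : V → M) := contMDiff_subtype_val
  have hι' : ∀ y : V, Function.Injective (mfderiv (𝓡 N) (𝓡 N) (Subtype.val : V → M) y) :=
    fun y ↦ by
      rw [Literature.Geometry.Manifold.OpenSubmanifold.mfderiv_subtype_val]
      exact fun a b h ↦ h
  set gV := g.comap contMDiff_pullbackBilin_holds (Subtype.val : V → M) hι hι' rfl with hgV_def
  haveI : gV.HasLeviCivita := gV.hasLeviCivita
  have hgV : gV.IsRiemannian := fun y v hv ↦ by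
    rw [hgV_def, val_comap, pullbackBilin_apply]
    exact hg _ _ fun h0 ↦ hv (hι' y (h0.trans (map_zero _).symm))
  have hφV : ContMDiff (𝓡 N) 𝓘(ℝ) 2 (φ ∘ Subtype.val : V → ℝ) := fun y ↦
    contMDiffAt_subtype_iff.mpr (hφ.contMDiffAt (V.isOpen.mem_nhds y.2))
  have hΔV : ∀ y : V, gV.dalembertian (φ ∘ Subtype.val) y = g.dalembertian φ y := fun y ↦
    g.dalembertian_comap contMDiff_pullbackBilin_holds hι hι' rfl
      (hφ.contMDiffAt (V.isOpen.mem_nhds y.2))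
  have hcV : Continuous (c ∘ Subtype.val : V → ℝ) :=
    hc.comp_continuous continuous_subtype_val fun y ↦ y.2
  have key := gV.dalembertian_supersolution_eq_of_exists_eq hgV hcV (fun y ↦ hc0 y y.2) hφV
    (fun y ↦ by rw [hΔV]; exact hpde y y.2) hm (fun y ↦ hmin y y.2) (x₀ := ⟨x₀, hx₀V⟩) hx₀
  intro x hx
  exact key ⟨x, hx⟩

end PseudoRiemannianMetric

open PseudoRiemannianMetric

/-! ## The minimum principle on an exterior region -/

section Exterior

variable {X : Type} [TopologicalSpace X] [ChartedSpace E3 X] [IsManifold (𝓡 3) ∞ X]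
  {e : AFEnd X} {U : Opens X}

omit [IsManifold (𝓡 3) ∞ X] in
/-- Reading in the chart of the end is additive: `endValue (u - v) = endValue u - endValue v`
(both sides vanish inside the ball). [folklore] -/
theorem endValue_sub (e : AFEnd X) (u v : X → ℝ) :
    endValue e (u - v) = endValue e u - endValue e v := by
  funext z
  by_cases hz : e.R < ‖z‖
  · simp only [Pi.sub_apply, endValue_of_lt e _ hz]
  · simp only [Pi.sub_apply, endValue_of_not_lt e _ hz, sub_zero]

omit [IsManifold (𝓡 3) ∞ X] in
/-- Limits at infinity in an end subtract: `u → a`, `v → b` give `u - v → a - b`. [folklore] -/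
theorem TendstoAtEnd.sub {u v : X → ℝ} {a b : ℝ} (hu : TendstoAtEnd e u a)
    (hv : TendstoAtEnd e v b) : TendstoAtEnd e (u - v) (a - b) := by
  unfold TendstoAtEnd
  rw [endValue_sub]
  exact Filter.Tendsto.sub hu hv

omit [IsManifold (𝓡 3) ∞ X] in
/-- From `u → c` at infinity in the end: every level `a < c` is exceeded on some far region,
`u > a` on `e.far R`. [folklore] -/
theorem TendstoAtEnd.exists_radius_lt {u : X → ℝ} {c a : ℝ} (hu : TendstoAtEnd e u c)
    (ha : a < c) : ∃ R, e.R ≤ R ∧ ∀ x ∈ e.far R, a < u x := by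
  have hev : ∀ᶠ z in Bornology.cobounded E3, a < endValue e u z := hu.eventually (lt_mem_nhds ha)
  obtain ⟨R₀, -, hR₀⟩ := (Filter.hasBasis_cobounded_norm (E := E3)).eventually_iff.1 hev
  refine ⟨max R₀ e.R, le_max_right _ _, fun x hx ↦ ?_⟩
  obtain ⟨z, hz, rfl⟩ := e.mem_far_iff.1 hx
  have hzR : e.R < ‖(z : E3)‖ := mem_exteriorRegion.1 z.2
  have h1 := hR₀ (show (z : E3) ∈ {x : E3 | R₀ ≤ ‖x‖} by
    simp only [mem_setOf_eq]; linarith [le_max_left R₀ e.R, hz.le])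
  rwa [endValue_of_lt e _ hzR] at h1

variable (h : ContMDiffRiemannianMetric (𝓡 3) ∞ E3 (TangentSpace (𝓡 3) : X → Type _))
  [(ofRiemannian h).HasLeviCivita]

/-- **The Laplace–Beltrami operator of an affine function of `f`**: `Δ_h (a f + b) = a Δ_h f` at
a point where `f` is `C²` (the chain rule `dalembertian_real_comp` with `ζ(s) = a s + b`,
`ζ' = a`, `ζ'' = 0`). [folklore] -/
theorem dalembertian_affine_apply {f : X → ℝ} {x : X} (a b : ℝ)
    (hf : ContMDiffAt (𝓡 3) 𝓘(ℝ, ℝ) 2 f x) :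
    (ofRiemannian h).dalembertian (fun y ↦ a * f y + b) x =
      a * (ofRiemannian h).dalembertian f x := by
  have hζ : ContDiffAt ℝ 2 (fun s : ℝ ↦ a * s + b) (f x) :=
    ((contDiff_const.mul contDiff_id).add contDiff_const).contDiffAt
  have hd : deriv (fun s : ℝ ↦ a * s + b) = fun _ ↦ a := by
    funext s
    have : HasDerivAt (fun s : ℝ ↦ a * s + b) a s := by
      simpa using ((hasDerivAt_id s).const_mul a).add_const b
    exact this.deriv
  have hdd : deriv (deriv (fun s : ℝ ↦ a * s + b)) = fun _ ↦ 0 := by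
    rw [hd]
    funext s
    exact deriv_const s a
  have key := (ofRiemannian h).dalembertian_real_comp hf hζ
  rw [hdd, hd] at key
  rw [show (fun y ↦ a * f y + b) = (fun s : ℝ ↦ a * s + b) ∘ f from rfl, key]
  ring

/-- **Minimum principle on an exterior region, with boundary values on the horizon and at
infinity.** Let `U` be an exterior region of the end `e` (connected, compact modulo the end),
`c ≥ 0` continuous on `U`, and `u` a function continuous on `closure U`, of class `C²` on `U` with
`Δ_h u ≤ c u` there (a supersolution of `−Δ_h + c`; e.g. `Δ_h u ≤ 0`, or the conformal equations
`Δ_h u = (R/8) u`, `R ≥ 0`, of Schoen–Yau and Bray), with `u ≥ 0` on `Σ = ∂U` and `liminf u ≥ 0`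
at infinity in the end (`u > -ε` on a far region, for every `ε > 0`). Then `u ≥ 0` on `U`. Proof:
a negative value would give a negative minimum of `u` over the compact set `closure U ∖ far R`
(`R` large), attained at an interior point of `U`, so that `u` would be a negative constant on
the connected `U` by E. Hopf's minimum principle
(`dalembertian_supersolution_eqOn_of_isPreconnected`) — impossible far out. This is the form of
the maximum principle behind Bray's use of "the" Green's function (86) (uniqueness, `0 < φ < 1`).
[cite: LopezGomez2012, Thm. 1.2] [cite: BrayRPI2001, §6 (86)] -/
theorem IsExteriorRegion.nonneg_of_dalembertian_le (hU : IsExteriorRegion e U) {u c : X → ℝ}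
    (huc : ContinuousOn u (closure (U : Set X))) (hu2 : ContMDiffOn (𝓡 3) 𝓘(ℝ, ℝ) 2 u U)
    (hc : ContinuousOn c (U : Set X)) (hc0 : ∀ x ∈ (U : Set X), 0 ≤ c x)
    (hΔ : ∀ x ∈ (U : Set X), (ofRiemannian h).dalembertian u x ≤ c x * u x)
    (hbdry : ∀ x ∈ frontier (U : Set X), 0 ≤ u x)
    (hinf : ∀ ε : ℝ, 0 < ε → ∃ R, ∀ x ∈ e.far R, -ε < u x) :
    ∀ x ∈ (U : Set X), 0 ≤ u x := by
  by_contra! hneg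
  obtain ⟨x₁, hx₁U, hx₁⟩ := hneg
  obtain ⟨hconn, R', -, hfarU, -⟩ := id hU
  set ε : ℝ := -u x₁ / 2 with hε_def
  have hε : 0 < ε := by rw [hε_def]; linarith
  obtain ⟨R₀, hR₀⟩ := hinf ε hε
  set R : ℝ := max R₀ R' with hR_def
  have hfarRU : e.far R ⊆ (U : Set X) := (e.far_mono (le_max_right R₀ R')).trans hfarU
  have hfarR : ∀ x ∈ e.far R, -ε < u x := fun x hx ↦ hR₀ x (e.far_mono (le_max_left R₀ R') hx)
  -- the minimum of `u` over the compact `closure U ∖ far R` is negative and interior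
  have hK : IsCompact (closure (U : Set X) \ e.far R) := hU.isCompact_closure_diff_far R
  have hx₁K : x₁ ∈ closure (U : Set X) \ e.far R :=
    ⟨subset_closure hx₁U, fun hx ↦ by have := hfarR x₁ hx; rw [hε_def] at this; linarith⟩
  obtain ⟨x₀, hx₀K, hmin⟩ := hK.exists_isMinOn ⟨x₁, hx₁K⟩ (huc.mono fun _ hy ↦ hy.1)
  have hm₁ : u x₀ ≤ u x₁ := hmin hx₁K
  have hm0 : u x₀ < 0 := hm₁.trans_lt hx₁
  have hx₀U : x₀ ∈ (U : Set X) := by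
    by_contra hx
    have hfr : x₀ ∈ frontier (U : Set X) := by
      rw [U.isOpen.frontier_eq]
      exact ⟨hx₀K.1, hx⟩
    linarith [hbdry x₀ hfr]
  have hlow : ∀ x ∈ (U : Set X), u x₀ ≤ u x := fun x hx ↦ by
    by_cases hxR : x ∈ e.far R
    · have := hfarR x hxR
      rw [hε_def] at this
      linarith
    · exact hmin ⟨subset_closure hx, hxR⟩
  -- E. Hopf: `u ≡ u x₀ < 0` on the connected `U`, impossible on the far region
  have hall := (ofRiemannian h).dalembertian_supersolution_eqOn_of_isPreconnected
    (isRiemannian_ofRiemannian h) hconn.isPreconnected hc hc0 hu2 hΔ hm0.le hlow hx₀U rfl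
  obtain ⟨x₂, hx₂⟩ := AFEnd.far_nonempty e R
  have h1 := hall x₂ (hfarRU hx₂)
  have h2 := hfarR x₂ hx₂
  rw [hε_def] at h2
  linarith

/-- **Minimum principle for superharmonic functions on an exterior region** (the case `c = 0` of
`IsExteriorRegion.nonneg_of_dalembertian_le`): `u` continuous on `closure U`, `C²` with
`Δ_h u ≤ 0` on `U`, `u ≥ 0` on `Σ = ∂U` and `liminf u ≥ 0` at infinity in the end, is `≥ 0` on
`U`. [cite: LopezGomez2012, Thm. 1.2] [cite: BrayRPI2001, §6 (86)] -/
theorem IsExteriorRegion.nonneg_of_dalembertian_nonpos (hU : IsExteriorRegion e U) {u : X → ℝ}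
    (huc : ContinuousOn u (closure (U : Set X))) (hu2 : ContMDiffOn (𝓡 3) 𝓘(ℝ, ℝ) 2 u U)
    (hΔ : ∀ x ∈ (U : Set X), (ofRiemannian h).dalembertian u x ≤ 0)
    (hbdry : ∀ x ∈ frontier (U : Set X), 0 ≤ u x)
    (hinf : ∀ ε : ℝ, 0 < ε → ∃ R, ∀ x ∈ e.far R, -ε < u x) :
    ∀ x ∈ (U : Set X), 0 ≤ u x :=
  hU.nonneg_of_dalembertian_le h huc hu2 (c := fun _ ↦ 0) continuousOn_const (fun _ _ ↦ le_rfl)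
    (fun x hx ↦ by rw [zero_mul]; exact hΔ x hx) hbdry hinf

/-- **Uniqueness for the exterior Dirichlet problem** (comparison form of the minimum principle):
two functions continuous on `closure U`, of class `C²` with the same Laplacian on the exterior
region `U`, equal on `Σ = ∂U` and with the same limit at infinity in the end (`u - v → 0`),
coincide on `U`. [cite: LopezGomez2012, Thm. 1.2] [cite: BrayRPI2001, §6 (86)] -/
theorem IsExteriorRegion.eqOn_of_dalembertian_eq (hU : IsExteriorRegion e U) {u v : X → ℝ}
    (huc : ContinuousOn u (closure (U : Set X))) (hvc : ContinuousOn v (closure (U : Set X)))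
    (hu2 : ContMDiffOn (𝓡 3) 𝓘(ℝ, ℝ) 2 u U) (hv2 : ContMDiffOn (𝓡 3) 𝓘(ℝ, ℝ) 2 v U)
    (hΔ : ∀ x ∈ (U : Set X), (ofRiemannian h).dalembertian u x = (ofRiemannian h).dalembertian v x)
    (hbdry : ∀ x ∈ frontier (U : Set X), u x = v x) (hinf : TendstoAtEnd e (u - v) 0) :
    ∀ x ∈ (U : Set X), u x = v x := by
  have hsub : ∀ {a b : X → ℝ}, ContMDiffOn (𝓡 3) 𝓘(ℝ, ℝ) 2 a U → ContMDiffOn (𝓡 3) 𝓘(ℝ, ℝ) 2 b U →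
      ∀ x ∈ (U : Set X), (ofRiemannian h).dalembertian (a - b) x =
        (ofRiemannian h).dalembertian a x - (ofRiemannian h).dalembertian b x :=
    fun ha hb x hx ↦ dalembertian_sub (ofRiemannian h) (ha.contMDiffAt (U.isOpen.mem_nhds hx))
      (hb.contMDiffAt (U.isOpen.mem_nhds hx))
  have h1 : ∀ x ∈ (U : Set X), 0 ≤ (u - v) x :=
    hU.nonneg_of_dalembertian_nonpos h (huc.sub hvc) (hu2.sub hv2)
      (fun x hx ↦ by rw [hsub hu2 hv2 x hx, hΔ x hx, sub_self])
      (fun x hx ↦ by rw [Pi.sub_apply, hbdry x hx, sub_self])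
      (fun ε hε ↦ by
        obtain ⟨R, -, hR⟩ := hinf.exists_radius_lt (show -ε < 0 by linarith)
        exact ⟨R, hR⟩)
  have hinf' : TendstoAtEnd e (v - u) 0 := by
    have : v - u = (fun _ ↦ (0 : ℝ)) - (u - v) := by
      funext x
      simp only [Pi.sub_apply]
      ring
    have key := (tendstoAtEnd_const e 0).sub hinf
    rw [sub_self] at key
    rw [this]
    exact key
  have h2 : ∀ x ∈ (U : Set X), 0 ≤ (v - u) x :=
    hU.nonneg_of_dalembertian_nonpos h (hvc.sub huc) (hv2.sub hu2)
      (fun x hx ↦ by rw [hsub hv2 hu2 x hx, hΔ x hx, sub_self])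
      (fun x hx ↦ by rw [Pi.sub_apply, hbdry x hx, sub_self])
      (fun ε hε ↦ by
        obtain ⟨R, -, hR⟩ := hinf'.exists_radius_lt (show -ε < 0 by linarith)
        exact ⟨R, hR⟩)
  intro x hx
  have a := h1 x hx
  have b := h2 x hx
  simp only [Pi.sub_apply] at a b
  linarith

/-! ## The capacity potential: bounds `0 ≤ φ₀ ≤ 1`, `0 < φ₀ < 1`, and uniqueness -/

/-- **A harmonic test function is nonnegative**: if `φ₀` is a test function of the capacity of
the horizon `Σ = ∂U` (continuous, smooth on the exterior region `U`, `0` on `Σ` and inside,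
`→ 1` at infinity) which is `h`-harmonic on `U`, then `φ₀ ≥ 0` on `X` (minimum principle on `U`,
boundary values `0` on `Σ` and `1` at infinity). Bray 2001, §6, the Green's function (86).
[cite: BrayRPI2001, §6 (86)] -/
theorem IsCapacityTestFn.nonneg_of_harmonic (hU : IsExteriorRegion e U) {φ₀ : X → ℝ}
    (hφ₀ : IsCapacityTestFn e U φ₀)
    (hΔ : ∀ x ∈ (U : Set X), (ofRiemannian h).dalembertian φ₀ x = 0) (x : X) : 0 ≤ φ₀ x := by
  have h2 : (2 : ℕ∞ω) ≤ ∞ := WithTop.coe_le_coe.mpr le_top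
  by_cases hx : x ∈ (U : Set X)
  · refine hU.nonneg_of_dalembertian_nonpos h hφ₀.continuous.continuousOn
      (hφ₀.contMDiffOn.of_le h2) (fun y hy ↦ (hΔ y hy).le)
      (fun y hy ↦ (hφ₀.eq_zero_of_mem_frontier hy).ge) (fun ε hε ↦ ?_) x hx
    obtain ⟨R, -, hR⟩ := hφ₀.tendstoAtEnd.exists_radius_lt (show -ε < 1 by linarith)
    exact ⟨R, hR⟩
  · exact (hφ₀.2.2.1 x hx).ge

/-- **A harmonic test function is at most `1`**: under the hypotheses of
`IsCapacityTestFn.nonneg_of_harmonic`, `φ₀ ≤ 1` on `X` (minimum principle for the harmonic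
function `1 - φ₀`, which is `1` on `Σ` and `→ 0` at infinity). Bray 2001, §6, (86).
[cite: BrayRPI2001, §6 (86)] -/
theorem IsCapacityTestFn.le_one_of_harmonic (hU : IsExteriorRegion e U) {φ₀ : X → ℝ}
    (hφ₀ : IsCapacityTestFn e U φ₀)
    (hΔ : ∀ x ∈ (U : Set X), (ofRiemannian h).dalembertian φ₀ x = 0) (x : X) : φ₀ x ≤ 1 := by
  have h2 : (2 : ℕ∞ω) ≤ ∞ := WithTop.coe_le_coe.mpr le_top
  by_cases hx : x ∈ (U : Set X)
  · have hfun : (fun y ↦ 1 - φ₀ y) = fun y ↦ (-1) * φ₀ y + 1 := funext fun y ↦ by ring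
    have key := hU.nonneg_of_dalembertian_nonpos h (u := fun y ↦ 1 - φ₀ y)
      (continuous_const.sub hφ₀.continuous).continuousOn
      ((contMDiffOn_const.sub hφ₀.contMDiffOn).of_le h2) (fun y hy ↦ ?_) (fun y hy ↦ ?_)
      (fun ε hε ↦ ?_) x hx
    · linarith
    · rw [hfun, dalembertian_affine_apply h (-1) 1
        ((hφ₀.contMDiffOn.of_le h2).contMDiffAt (U.isOpen.mem_nhds hy)), hΔ y hy, mul_zero]
    · rw [hφ₀.eq_zero_of_mem_frontier hy, sub_zero]
      exact zero_le_one
    · obtain ⟨R, -, hR⟩ := ((tendstoAtEnd_const e 1).sub hφ₀.tendstoAtEnd).exists_radius_lt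
        (show -ε < 1 - 1 by linarith)
      exact ⟨R, fun y hy ↦ hR y hy⟩
  · rw [hφ₀.2.2.1 x hx]
    exact zero_le_one

/-- **A harmonic test function is positive on the exterior region**: under the hypotheses of
`IsCapacityTestFn.nonneg_of_harmonic`, `0 < φ₀` on `U` (if `φ₀ ≥ 0` vanished at a point of the
connected `U` it would vanish identically on `U` by E. Hopf's minimum principle, whereas
`φ₀ → 1` far out). Bray 2001, §6, (86). [cite: BrayRPI2001, §6 (86)]
[cite: LopezGomez2012, Thm. 1.2] -/
theorem IsCapacityTestFn.pos_of_harmonic (hU : IsExteriorRegion e U) {φ₀ : X → ℝ}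
    (hφ₀ : IsCapacityTestFn e U φ₀)
    (hΔ : ∀ x ∈ (U : Set X), (ofRiemannian h).dalembertian φ₀ x = 0) {x : X}
    (hx : x ∈ (U : Set X)) : 0 < φ₀ x := by
  have h2 : (2 : ℕ∞ω) ≤ ∞ := WithTop.coe_le_coe.mpr le_top
  have h0 := hφ₀.nonneg_of_harmonic h hU hΔ
  by_contra hle
  have hx0 : φ₀ x = 0 := le_antisymm (not_lt.1 hle) (h0 x)
  have hall := (ofRiemannian h).dalembertian_supersolution_eqOn_of_isPreconnected
    (isRiemannian_ofRiemannian h) hU.1.isPreconnected (c := fun _ ↦ (0 : ℝ)) continuousOn_const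
    (fun _ _ ↦ le_rfl) (hφ₀.contMDiffOn.of_le h2) (fun y hy ↦ by rw [zero_mul, hΔ y hy]) le_rfl
    (fun y _ ↦ h0 y) hx hx0
  obtain ⟨R, -, hR⟩ := hφ₀.tendstoAtEnd.exists_radius_lt (show (1 : ℝ) / 2 < 1 by norm_num)
  obtain ⟨-, R', -, hfarU, -⟩ := hU
  obtain ⟨x₂, hx₂⟩ := AFEnd.far_nonempty e (max R R')
  have h1 := hall x₂ (hfarU (e.far_mono (le_max_right R R') hx₂))
  have h3 := hR x₂ (e.far_mono (le_max_left R R') hx₂)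
  linarith

/-- **A harmonic test function is `< 1` on the exterior region of a nonempty horizon**: under
the hypotheses of `IsCapacityTestFn.nonneg_of_harmonic` and if `Σ = frontier U ≠ ∅`, `φ₀ < 1` on
`U` (if `1 - φ₀ ≥ 0` vanished at a point of `U` it would vanish on `U`, whereas `φ₀` is small
near `Σ`, where it vanishes). Bray 2001, §6, (86). [cite: BrayRPI2001, §6 (86)]
[cite: LopezGomez2012, Thm. 1.2] -/
theorem IsCapacityTestFn.lt_one_of_harmonic (hU : IsExteriorRegion e U) {φ₀ : X → ℝ}
    (hφ₀ : IsCapacityTestFn e U φ₀)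
    (hΔ : ∀ x ∈ (U : Set X), (ofRiemannian h).dalembertian φ₀ x = 0)
    (hfr : (frontier (U : Set X)).Nonempty) {x : X} (hx : x ∈ (U : Set X)) : φ₀ x < 1 := by
  have h2 : (2 : ℕ∞ω) ≤ ∞ := WithTop.coe_le_coe.mpr le_top
  have h1 := hφ₀.le_one_of_harmonic h hU hΔ
  by_contra hle
  have hx1 : φ₀ x = 1 := le_antisymm (h1 x) (not_lt.1 hle)
  have hfun : (fun y ↦ 1 - φ₀ y) = fun y ↦ (-1) * φ₀ y + 1 := funext fun y ↦ by ring
  have hall := (ofRiemannian h).dalembertian_supersolution_eqOn_of_isPreconnected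
    (isRiemannian_ofRiemannian h) hU.1.isPreconnected (c := fun _ ↦ (0 : ℝ)) continuousOn_const
    (fun _ _ ↦ le_rfl) (φ := fun y ↦ 1 - φ₀ y) ((contMDiffOn_const.sub hφ₀.contMDiffOn).of_le h2)
    (fun y hy ↦ by
      rw [zero_mul, hfun, dalembertian_affine_apply h (-1) 1
        ((hφ₀.contMDiffOn.of_le h2).contMDiffAt (U.isOpen.mem_nhds hy)), hΔ y hy, mul_zero])
    le_rfl (fun y _ ↦ sub_nonneg.2 (h1 y)) hx (by simp only [hx1, sub_self])
  -- a point of `U` near the horizon where `φ₀ < 1/2`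
  obtain ⟨x₂, hx₂⟩ := hfr
  have hφx₂ : φ₀ x₂ = 0 := hφ₀.eq_zero_of_mem_frontier hx₂
  have hev : ∀ᶠ y in 𝓝 x₂, φ₀ y < 1 / 2 :=
    hφ₀.continuous.continuousAt.eventually (gt_mem_nhds (by rw [hφx₂]; norm_num))
  obtain ⟨y, hy, hyU⟩ := (mem_closure_iff_nhds.1 (frontier_subset_closure hx₂)) _ hev
  have := hall y hyU
  have hy' : φ₀ y < 1 / 2 := hy
  linarith

/-- **`0 < φ₀ < 1` on the exterior region of a nonempty horizon** for every `h`-harmonic test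
function `φ₀` of its capacity (`pos_of_harmonic` and `lt_one_of_harmonic`): the hypothesis `h01`
of `horizonCapacity_eq_of_harmonic` (`MassCapacityHarmonic.lean`) holds automatically.
Bray 2001, §6, (86). [cite: BrayRPI2001, §6 (86)] -/
theorem IsCapacityTestFn.pos_lt_one_of_harmonic (hU : IsExteriorRegion e U) {φ₀ : X → ℝ}
    (hφ₀ : IsCapacityTestFn e U φ₀)
    (hΔ : ∀ x ∈ (U : Set X), (ofRiemannian h).dalembertian φ₀ x = 0)
    (hfr : (frontier (U : Set X)).Nonempty) :
    ∀ x ∈ (U : Set X), 0 < φ₀ x ∧ φ₀ x < 1 := fun _ hx ↦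
  ⟨hφ₀.pos_of_harmonic h hU hΔ hx, hφ₀.lt_one_of_harmonic h hU hΔ hfr hx⟩

omit [IsManifold (𝓡 3) ∞ X] [(ofRiemannian h).HasLeviCivita] in
/-- The outside region of a *nonempty* surface `Σ ∈ 𝒮` has nonempty frontier `Σ = range f'`.
Bray 2001, §2 Def. 3. [cite: BrayRPI2001, §2 Def. 3] -/
theorem IsOutsideOf.frontier_nonempty {S' : Type*} [Nonempty S'] {f' : S' → X}
    {ν' : NormalField (𝓡 3) f'} (hU : IsOutsideOf e U f' ν') :
    (frontier (U : Set X)).Nonempty := by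
  rw [hU.frontier_eq]
  exact range_nonempty f'

/-- **On the exterior region of the empty horizon a harmonic test function is `≡ 1`**: under the
hypotheses of `IsCapacityTestFn.nonneg_of_harmonic` and if `frontier U = ∅` (so `closure U = U`:
no horizon), `φ₀ = 1` on `U` (minimum principle for `φ₀ - 1 → 0`, no boundary values to check;
with `φ₀ ≤ 1`). Then the capacity vanishes (`horizonCapacity_top`). [cite: BrayRPI2001, §6 (86)] -/
theorem IsCapacityTestFn.eq_one_of_harmonic_of_frontier_eq_empty (hU : IsExteriorRegion e U)
    {φ₀ : X → ℝ} (hφ₀ : IsCapacityTestFn e U φ₀)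
    (hΔ : ∀ x ∈ (U : Set X), (ofRiemannian h).dalembertian φ₀ x = 0)
    (hfr : frontier (U : Set X) = ∅) {x : X} (hx : x ∈ (U : Set X)) : φ₀ x = 1 := by
  have h2 : (2 : ℕ∞ω) ≤ ∞ := WithTop.coe_le_coe.mpr le_top
  have h1 := hφ₀.le_one_of_harmonic h hU hΔ x
  have hfun : (fun y ↦ φ₀ y - 1) = fun y ↦ 1 * φ₀ y + (-1) := funext fun y ↦ by ring
  have key := hU.nonneg_of_dalembertian_nonpos h (u := fun y ↦ φ₀ y - 1)
    (hφ₀.continuous.sub continuous_const).continuousOn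
    ((hφ₀.contMDiffOn.sub contMDiffOn_const).of_le h2) (fun y hy ↦ ?_) (fun y hy ↦ ?_)
    (fun ε hε ↦ ?_) x hx
  · linarith
  · rw [hfun, dalembertian_affine_apply h 1 (-1)
      ((hφ₀.contMDiffOn.of_le h2).contMDiffAt (U.isOpen.mem_nhds hy)), hΔ y hy, mul_zero]
  · rw [hfr] at hy
    exact hy.elim
  · obtain ⟨R, -, hR⟩ := hφ₀.tendstoAtEnd.exists_radius_lt (show 1 - ε < 1 by linarith)
    exact ⟨R, fun y hy ↦ by linarith [hR y hy]⟩

/-- **Uniqueness of the capacity potential** ("Define the Green's function to be *the* function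
`φ` which satisfies (86)", Bray 2001, §6): two test functions of the capacity of `Σ = ∂U` which
are `h`-harmonic on the exterior region `U` coincide — their difference is harmonic on `U`,
vanishes on `Σ` and at infinity, hence is `≥ 0` and `≤ 0` on `U` by the minimum principle
(`IsExteriorRegion.nonneg_of_dalembertian_nonpos`), and both vanish off `U`. No energy or decay
hypothesis is needed. [cite: BrayRPI2001, §6 (86)] [cite: LopezGomez2012, Thm. 1.2] -/
theorem IsCapacityTestFn.eq_of_harmonic (hU : IsExteriorRegion e U) {φ₀ φ₁ : X → ℝ}
    (hφ₀ : IsCapacityTestFn e U φ₀) (hφ₁ : IsCapacityTestFn e U φ₁)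
    (hΔ₀ : ∀ x ∈ (U : Set X), (ofRiemannian h).dalembertian φ₀ x = 0)
    (hΔ₁ : ∀ x ∈ (U : Set X), (ofRiemannian h).dalembertian φ₁ x = 0) : φ₀ = φ₁ := by
  have h2 : (2 : ℕ∞ω) ≤ ∞ := WithTop.coe_le_coe.mpr le_top
  suffices key : ∀ {ψ₀ ψ₁ : X → ℝ}, IsCapacityTestFn e U ψ₀ → IsCapacityTestFn e U ψ₁ →
      (∀ x ∈ (U : Set X), (ofRiemannian h).dalembertian ψ₀ x = 0) →
      (∀ x ∈ (U : Set X), (ofRiemannian h).dalembertian ψ₁ x = 0) →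
      ∀ x ∈ (U : Set X), 0 ≤ ψ₁ x - ψ₀ x by
    funext x
    by_cases hx : x ∈ (U : Set X)
    · exact le_antisymm (sub_nonneg.1 (key hφ₀ hφ₁ hΔ₀ hΔ₁ x hx))
        (sub_nonneg.1 (key hφ₁ hφ₀ hΔ₁ hΔ₀ x hx))
    · rw [hφ₀.2.2.1 x hx, hφ₁.2.2.1 x hx]
  intro ψ₀ ψ₁ hψ₀ hψ₁ hΔ₀' hΔ₁'
  refine hU.nonneg_of_dalembertian_nonpos h (u := fun y ↦ ψ₁ y - ψ₀ y)
    (hψ₁.continuous.sub hψ₀.continuous).continuousOn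
    ((hψ₁.contMDiffOn.sub hψ₀.contMDiffOn).of_le h2) (fun y hy ↦ ?_) (fun y hy ↦ ?_)
    (fun ε hε ↦ ?_)
  · have hy1 : ContMDiffAt (𝓡 3) 𝓘(ℝ, ℝ) 2 ψ₁ y :=
      (hψ₁.contMDiffOn.of_le h2).contMDiffAt (U.isOpen.mem_nhds hy)
    have hy0 : ContMDiffAt (𝓡 3) 𝓘(ℝ, ℝ) 2 ψ₀ y :=
      (hψ₀.contMDiffOn.of_le h2).contMDiffAt (U.isOpen.mem_nhds hy)
    have hsub := dalembertian_sub (ofRiemannian h) hy1 hy0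
    rw [show (fun y ↦ ψ₁ y - ψ₀ y) = ψ₁ - ψ₀ from rfl, hsub, hΔ₁' y hy, hΔ₀' y hy, sub_zero]
  · rw [hψ₁.eq_zero_of_mem_frontier hy, hψ₀.eq_zero_of_mem_frontier hy, sub_zero]
  · obtain ⟨R, -, hR⟩ := (hψ₁.tendstoAtEnd.sub hψ₀.tendstoAtEnd).exists_radius_lt
      (show -ε < 1 - 1 by linarith)
    exact ⟨R, fun y hy ↦ hR y hy⟩

end Exterior

/-! ## The capacity theorems without the hypothesis `0 < φ₀ < 1` -/

section Capacity

open scoped ENNReal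
open Bornology Asymptotics

variable {X : Type} [TopologicalSpace X] [ChartedSpace E3 X] [IsManifold (𝓡 3) ∞ X]
  {e : AFEnd X} {U : Opens X}

omit [IsManifold (𝓡 3) ∞ X] in
/-- **A function equal to `1` far out has no monopole term**: if `φ₀ = 1` on a far region of the
end and `‖D(φ₀ ∘ Φ − (1 − c/r))(z)‖ = O(‖z‖⁻³)`, then `c = 0` (far out the function inside the
derivative is `c/r`, whose gradient `−c z/‖z‖³` has the component `−c/‖z‖²` along the first axis
at the points of that axis, which is `O(‖z‖⁻³)` only for `c = 0`). [folklore] -/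
theorem eq_zero_of_expansion_of_eqOn_far {φ₀ : X → ℝ} {R₁ : ℝ}
    (h1 : ∀ x ∈ e.far R₁, φ₀ x = 1) {c : ℝ}
    (hexp : (fun x : E3 ↦ ‖fderiv ℝ (fun y ↦ endValue e φ₀ y - (1 - c / ‖y‖)) x‖)
      =O[cobounded E3] fun x ↦ ‖x‖ ^ (-3 : ℝ)) : c = 0 := by
  obtain ⟨C, hC⟩ := hexp.bound
  obtain ⟨R₀, -, hR₀⟩ := (Filter.hasBasis_cobounded_norm (E := E3)).eventually_iff.1 hC
  set F : E3 → ℝ := fun y ↦ endValue e φ₀ y - (1 - c / ‖y‖) with hF_def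
  -- far out, `F = c/r`
  have hFeq : ∀ z : E3, max R₁ e.R < ‖z‖ → F =ᶠ[𝓝 z] fun y ↦ 0 + c / ‖y‖ := by
    intro z hz
    filter_upwards [(isOpen_lt continuous_const continuous_norm).mem_nhds hz] with y hy
    have hyR : e.R < ‖y‖ := lt_of_le_of_lt (le_max_right _ _) hy
    have hy1 : R₁ < ‖y‖ := lt_of_le_of_lt (le_max_left _ _) hy
    have hval : endValue e φ₀ y = 1 := by
      rw [endValue_of_lt e _ hyR]
      exact h1 _ (e.mem_far_iff.2 ⟨⟨y, mem_exteriorRegion.2 hyR⟩, hy1, rfl⟩)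
    simp only [hF_def, hval]
    ring
  by_contra hc
  have hcpos : 0 < |c| := abs_pos.2 hc
  -- a point `z = T e₀` far out on the first axis
  set T : ℝ := max (max R₀ (max R₁ e.R)) (C / |c|) + 1 with hT_def
  have hTa : max R₀ (max R₁ e.R) < T := by
    rw [hT_def]
    linarith [le_max_left (max R₀ (max R₁ e.R)) (C / |c|)]
  have hTR₀ : R₀ ≤ T := (le_max_left R₀ (max R₁ e.R)).trans hTa.le
  have hTR : max R₁ e.R < T := lt_of_le_of_lt (le_max_right R₀ (max R₁ e.R)) hTa
  have hTC : C / |c| < T := by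
    rw [hT_def]
    linarith [le_max_right (max R₀ (max R₁ e.R)) (C / |c|)]
  have hT0 : 0 < T := e.R_pos.trans (lt_of_le_of_lt (le_max_right R₁ e.R) hTR)
  set z : E3 := T • EuclideanSpace.single (0 : Fin 3) (1 : ℝ) with hz_def
  have hzn : ‖z‖ = T := by
    rw [hz_def, norm_smul, Real.norm_of_nonneg hT0.le]
    simp
  have hz0 : z ≠ 0 := fun h0 ↦ by
    rw [h0, norm_zero] at hzn
    linarith
  have hzc : z 0 = T := by simp [hz_def]
  -- the derivative of `F` at `z` along `e₀` is `-c/T²`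
  have hderiv : fderiv ℝ F z (EuclideanSpace.single 0 1) = -c * z 0 / ‖z‖ ^ 3 := by
    rw [(hFeq z (by rw [hzn]; exact hTR)).fderiv_eq]
    exact fderiv_const_add_div_norm_apply 0 c hz0 0
  rw [hzc, hzn] at hderiv
  have hval : |fderiv ℝ F z (EuclideanSpace.single 0 1)| = |c| / T ^ 2 := by
    rw [hderiv, show -c * T / T ^ 3 = -(c / T ^ 2) by field_simp, abs_neg, abs_div,
      abs_of_pos (by positivity : (0 : ℝ) < T ^ 2)]
  -- and it is bounded by `‖DF(z)‖ ≤ C T⁻³`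
  have hb := hR₀ (show z ∈ {x : E3 | R₀ ≤ ‖x‖} by rw [mem_setOf_eq, hzn]; exact hTR₀)
  have hrpow : ‖z‖ ^ (-3 : ℝ) = (T ^ 3)⁻¹ := by
    rw [hzn, Real.rpow_neg hT0.le, show (3 : ℝ) = ((3 : ℕ) : ℝ) by norm_num, Real.rpow_natCast]
  rw [Real.norm_of_nonneg (norm_nonneg _), Real.norm_of_nonneg (Real.rpow_nonneg (norm_nonneg _) _),
    hrpow] at hb
  have hle : |c| / T ^ 2 ≤ C * (T ^ 3)⁻¹ := by
    rw [← hval, ← Real.norm_eq_abs]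
    refine (ContinuousLinearMap.le_opNorm _ _).trans ?_
    have hn1 : ‖EuclideanSpace.single (0 : Fin 3) (1 : ℝ)‖ = 1 := by simp
    rw [hn1, mul_one]
    exact hb
  -- hence `|c| T ≤ C`, contradicting the choice of `T`
  have hkey : |c| * T ≤ C := by
    rw [← div_eq_mul_inv, div_le_div_iff₀ (by positivity) (by positivity)] at hle
    have h' : |c| * T * T ^ 2 ≤ C * T ^ 2 := by nlinarith [hle]
    exact le_of_mul_le_mul_right h' (by positivity)
  have : T ≤ C / |c| := by
    rw [le_div_iff₀ hcpos, mul_comm]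
    exact hkey
  linarith

variable [T2Space X] [LocallyCompactSpace X] [SigmaCompactSpace X] [MeasurableSpace X]
  [BorelSpace X]

section HMetric

variable (h : ContMDiffRiemannianMetric (𝓡 3) ∞ E3 (TangentSpace (𝓡 3) : X → Type _))
  [(ofRiemannian h).HasLeviCivita]

omit [T2Space X] [LocallyCompactSpace X] [SigmaCompactSpace X] [MeasurableSpace X] [BorelSpace X] in
/-- **A harmonic test function of the empty horizon has slope zero**: under the hypotheses of
`IsCapacityTestFn.eq_one_of_harmonic_of_frontier_eq_empty` (`frontier U = ∅`), `|∇φ₀| = 0`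
everywhere (`φ₀` is locally constant: `1` on the clopen `U`, `0` off it). [folklore] -/
theorem IsCapacityTestFn.gradNorm_eq_zero_of_harmonic_of_frontier_eq_empty
    (hU : IsExteriorRegion e U) {φ₀ : X → ℝ} (hφ₀ : IsCapacityTestFn e U φ₀)
    (hΔ : ∀ x ∈ (U : Set X), (ofRiemannian h).dalembertian φ₀ x = 0)
    (hfr : frontier (U : Set X) = ∅) (x : X) : gradNorm h φ₀ x = 0 := by
  by_cases hx : x ∈ (U : Set X)
  · exact gradNorm_eq_zero_of_eventuallyEq_const h
      (Filter.eventuallyEq_of_mem (U.isOpen.mem_nhds hx) fun y hy ↦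
        hφ₀.eq_one_of_harmonic_of_frontier_eq_empty h hU hΔ hfr hy)
  · have hcl : closure (U : Set X) = U := by
      rw [closure_eq_interior_union_frontier, hfr, union_empty, U.isOpen.interior_eq]
    have hxc : x ∉ closure (U : Set X) := by rwa [hcl]
    exact gradNorm_eq_zero_of_eventuallyEq_const h
      (Filter.eventuallyEq_of_mem (isClosed_closure.isOpen_compl.mem_nhds hxc) fun y hy ↦
        hφ₀.2.2.1 y fun hyU ↦ hy (subset_closure hyU))

/-- **`ℰ(Σ, g) = (1/2π) ∫_U |∇φ₀|²` for the harmonic potential, without sign hypotheses** — the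
main theorem `horizonCapacity_eq_of_harmonic` of `MassCapacityHarmonic.lean` with its hypothesis
`0 < φ₀ < 1` on `U` removed: that property HOLDS for every `h`-harmonic test function by the
maximum principle when the horizon `Σ = frontier U` is nonempty (`IsCapacityTestFn.pos_of_harmonic`,
`IsCapacityTestFn.lt_one_of_harmonic`), and when `Σ = ∅` both sides vanish (`φ₀ ≡ 1` on `U`,
`horizonCapacity_le`). Hypotheses: `U` an exterior region of `e`, `φ₀` a test function of the
capacity, `h`-harmonic on `U`, with `∫_U |∇φ₀|² < ∞`. Bray 2001, §6, Def. 17 with (86) ("the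
infimum … is achieved by the Green's function"). [cite: BrayRPI2001, §6 Def. 17 with (86)] -/
theorem horizonCapacity_eq_of_harmonic' (hU : IsExteriorRegion e U) {φ₀ : X → ℝ}
    (hφ₀ : IsCapacityTestFn e U φ₀)
    (hΔ : ∀ x ∈ (U : Set X), (ofRiemannian h).dalembertian φ₀ x = 0)
    (hfin : ∫⁻ x in (U : Set X), ENNReal.ofReal (gradNorm h φ₀ x ^ 2) ∂riemannianMeasure h < ⊤) :
    horizonCapacity h e U = ENNReal.ofReal (2 * π)⁻¹ *
      ∫⁻ x in (U : Set X), ENNReal.ofReal (gradNorm h φ₀ x ^ 2) ∂riemannianMeasure h := by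
  by_cases hfr : (frontier (U : Set X)).Nonempty
  · exact horizonCapacity_eq_of_harmonic h hU hφ₀ hΔ
      (fun x hx ↦ ⟨hφ₀.pos_of_harmonic h hU hΔ hx, hφ₀.lt_one_of_harmonic h hU hΔ hfr hx⟩) hfin
  · rw [not_nonempty_iff_eq_empty] at hfr
    have hgrad := hφ₀.gradNorm_eq_zero_of_harmonic_of_frontier_eq_empty h hU hΔ hfr
    have hE : dirichletEnergy h φ₀ = 0 := by
      simp [dirichletEnergy, hgrad]
    have hcap : horizonCapacity h e U = 0 :=
      nonpos_iff_eq_zero.1 ((horizonCapacity_le h e U hφ₀).trans (by simp [hE]))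
    rw [hcap]
    simp [hgrad]

/-- **The Dirichlet principle for the harmonic potential, without sign hypotheses**
(`setLIntegral_gradNorm_sq_le_dirichletEnergy_of_harmonic` with `0 < φ₀ < 1` removed): every
test function `φ` has `∫_U |∇φ₀|² ≤ ∫_X |∇φ|²`. [cite: BrayRPI2001, §6 Def. 17 with (86)] -/
theorem setLIntegral_gradNorm_sq_le_dirichletEnergy_of_harmonic' (hU : IsExteriorRegion e U)
    {φ₀ : X → ℝ} (hφ₀ : IsCapacityTestFn e U φ₀)
    (hΔ : ∀ x ∈ (U : Set X), (ofRiemannian h).dalembertian φ₀ x = 0)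
    (hfin : ∫⁻ x in (U : Set X), ENNReal.ofReal (gradNorm h φ₀ x ^ 2) ∂riemannianMeasure h < ⊤)
    {φ : X → ℝ} (hφ : IsCapacityTestFn e U φ) :
    ∫⁻ x in (U : Set X), ENNReal.ofReal (gradNorm h φ₀ x ^ 2) ∂riemannianMeasure h ≤
      dirichletEnergy h φ := by
  have h1 := horizonCapacity_le h e U hφ
  rw [horizonCapacity_eq_of_harmonic' h hU hφ₀ hΔ hfin] at h1
  exact (ENNReal.mul_le_mul_iff_right (ENNReal.ofReal_pos.2 (by positivity)).ne'
    ENNReal.ofReal_ne_top).1 h1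

/-- **`ℰ(Σ, g)` as a real number, without sign hypotheses** (`horizonCapacity_toReal_eq_of_harmonic`
with `0 < φ₀ < 1` removed): `(horizonCapacity h e U).toReal = (1/2π) ∫_U |∇φ₀|²_h dV_h`.
[cite: BrayRPI2001, §6 Def. 17 with (86)] -/
theorem horizonCapacity_toReal_eq_of_harmonic' (hU : IsExteriorRegion e U) {φ₀ : X → ℝ}
    (hφ₀ : IsCapacityTestFn e U φ₀)
    (hΔ : ∀ x ∈ (U : Set X), (ofRiemannian h).dalembertian φ₀ x = 0)
    (hfin : ∫⁻ x in (U : Set X), ENNReal.ofReal (gradNorm h φ₀ x ^ 2) ∂riemannianMeasure h < ⊤) :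
    (horizonCapacity h e U).toReal =
      (2 * π)⁻¹ * ∫ x in (U : Set X), gradNorm h φ₀ x ^ 2 ∂riemannianMeasure h := by
  have hUo : IsOpen (U : Set X) := U.isOpen
  have h1le : (1 : ℕ∞ω) ≤ ((⊤ : ℕ∞) : ℕ∞ω) := by exact_mod_cast le_top
  have hφ₀1 : ContMDiffOn (𝓡 3) 𝓘(ℝ, ℝ) 1 φ₀ U := hφ₀.contMDiffOn.of_le h1le
  have hgc : ContinuousOn (fun x ↦ gradNorm h φ₀ x ^ 2) U := by
    have hg' : (fun x ↦ gradNorm h φ₀ x ^ 2) = fun x ↦ (ofRiemannian h).innerDual x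
        (mvfderiv (𝓡 3) φ₀ x).toLinearMap (mvfderiv (𝓡 3) φ₀ x).toLinearMap :=
      funext fun x ↦ gradNorm_sq_eq_innerDual_mvfderiv h φ₀ x
    rw [hg']
    exact continuousOn_innerDual_mvfderiv h hUo hφ₀1 hφ₀1
  have hg0 : ∀ x, 0 ≤ gradNorm h φ₀ x ^ 2 := fun x ↦ sq_nonneg _
  have hgi : Integrable (fun x ↦ gradNorm h φ₀ x ^ 2) ((riemannianMeasure h).restrict U) :=
    ⟨hgc.aestronglyMeasurable hUo.measurableSet,
      (hasFiniteIntegral_iff_ofReal (Eventually.of_forall hg0)).2 hfin⟩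
  rw [horizonCapacity_eq_of_harmonic' h hU hφ₀ hΔ hfin,
    ← ofReal_integral_eq_lintegral_ofReal hgi (Eventually.of_forall fun x ↦ hg0 x),
    ENNReal.toReal_mul, ENNReal.toReal_ofReal (by positivity),
    ENNReal.toReal_ofReal (setIntegral_nonneg hUo.measurableSet fun x _ ↦ hg0 x)]

end HMetric

/-! ### In terms of the monopole coefficient of the potential -/

section Data

variable (D : InitialDataSet (𝓡 3) X) [D.metric.HasLeviCivita]

/-- **`∫_U |∇φ₀|² = 4πc` for the harmonic potential `φ₀ = 1 − c/r + O₁(r⁻²)`, without sign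
hypotheses** (`setIntegral_gradNorm_sq_eq_of_harmonic_of_expansion` of `MassCapacityExpansion.lean`
with `0 < φ₀ < 1` removed; for the empty horizon `φ₀ ≡ 1` on `U` and the expansion forces `c = 0`,
`eq_zero_of_expansion_of_eqOn_far`). [cite: BrayRPI2001, §6 (86)–(87)] -/
theorem setIntegral_gradNorm_sq_eq_of_harmonic_of_expansion' {α : ℝ} (hα : 0 < α)
    (hAF : e.IsMetricAsymptoticallyFlat D α) (hU : IsExteriorRegion e U) {φ₀ : X → ℝ}
    (hφ₀ : IsCapacityTestFn e U φ₀)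
    (hΔ : ∀ x ∈ (U : Set X), D.metric.dalembertian φ₀ x = 0)
    (hfin : ∫⁻ x in (U : Set X), ENNReal.ofReal (gradNorm D.h φ₀ x ^ 2) ∂riemannianMeasure D.h < ⊤)
    {c : ℝ}
    (hexp : (fun x : E3 ↦ ‖fderiv ℝ (fun y ↦ endValue e φ₀ y - (1 - c / ‖y‖)) x‖)
      =O[cobounded E3] fun x ↦ ‖x‖ ^ (-3 : ℝ)) :
    ∫ x in (U : Set X), gradNorm D.h φ₀ x ^ 2 ∂riemannianMeasure D.h = 4 * Real.pi * c := by
  haveI : (PseudoRiemannianMetric.ofRiemannian D.h).HasLeviCivita := ‹D.metric.HasLeviCivita›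
  by_cases hfr : (frontier (U : Set X)).Nonempty
  · exact setIntegral_gradNorm_sq_eq_of_harmonic_of_expansion D hα hAF hU hφ₀ hΔ
      (fun x hx ↦ ⟨hφ₀.pos_of_harmonic D.h hU hΔ hx, hφ₀.lt_one_of_harmonic D.h hU hΔ hfr hx⟩)
      hfin hexp
  · rw [not_nonempty_iff_eq_empty] at hfr
    obtain ⟨-, R', -, hfarU, -⟩ := id hU
    have hc : c = 0 := eq_zero_of_expansion_of_eqOn_far
      (fun x hx ↦ hφ₀.eq_one_of_harmonic_of_frontier_eq_empty D.h hU hΔ hfr (hfarU hx)) hexp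
    have hI : ∫ x in (U : Set X), gradNorm D.h φ₀ x ^ 2 ∂riemannianMeasure D.h = 0 := by
      refine (setIntegral_congr_fun U.isOpen.measurableSet fun x _ ↦ ?_).trans
        (integral_zero X ℝ)
      rw [hφ₀.gradNorm_eq_zero_of_harmonic_of_frontier_eq_empty D.h hU hΔ hfr x]
      ring
    rw [hI, hc, mul_zero]

/-- **`ℰ(Σ, g) = 2c` for the harmonic potential `φ₀ = 1 - c/|x| + O₁(|x|⁻²)`, without sign
hypotheses** (`horizonCapacity_eq_ofReal_of_harmonic_of_expansion` with `0 < φ₀ < 1` removed):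
the capacity of Def. 17 is twice the monopole coefficient of its Green's function (86)–(87).
[cite: BrayRPI2001, §6 (86)–(87)] -/
theorem horizonCapacity_eq_ofReal_of_harmonic_of_expansion' {α : ℝ} (hα : 0 < α)
    (hAF : e.IsMetricAsymptoticallyFlat D α) (hU : IsExteriorRegion e U) {φ₀ : X → ℝ}
    (hφ₀ : IsCapacityTestFn e U φ₀)
    (hΔ : ∀ x ∈ (U : Set X), D.metric.dalembertian φ₀ x = 0)
    (hfin : ∫⁻ x in (U : Set X), ENNReal.ofReal (gradNorm D.h φ₀ x ^ 2) ∂riemannianMeasure D.h < ⊤)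
    {c : ℝ}
    (hexp : (fun x : E3 ↦ ‖fderiv ℝ (fun y ↦ endValue e φ₀ y - (1 - c / ‖y‖)) x‖)
      =O[cobounded E3] fun x ↦ ‖x‖ ^ (-3 : ℝ)) :
    horizonCapacity D.h e U = ENNReal.ofReal (2 * c) := by
  haveI : (PseudoRiemannianMetric.ofRiemannian D.h).HasLeviCivita := ‹D.metric.HasLeviCivita›
  have hE := setIntegral_gradNorm_sq_eq_of_harmonic_of_expansion' D hα hAF hU hφ₀ hΔ hfin hexp
  have htop : horizonCapacity D.h e U ≠ ⊤ := by
    rw [horizonCapacity_eq_of_harmonic' D.h hU hφ₀ hΔ hfin]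
    exact ENNReal.mul_ne_top ENNReal.ofReal_ne_top hfin.ne
  have hreal := horizonCapacity_toReal_eq_of_harmonic' D.h hU hφ₀ hΔ hfin
  rw [hE] at hreal
  have h2c : (horizonCapacity D.h e U).toReal = 2 * c := by
    rw [hreal]
    field_simp
    ring
  rw [← ENNReal.ofReal_toReal htop, h2c]

/-- **`½ ℰ(Σ, g) = c`, without sign hypotheses** — the left-hand side of Bray's Theorem 9
(`m ≥ ½ ℰ(Σ, g)`, the named fact `Bray2001_mass_ge_half_capacity`) in terms of the monopole
coefficient of the harmonic potential (`horizonCapacity_toReal_div_two_eq_of_harmonic_of_expansion`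
with `0 < φ₀ < 1` removed): `(horizonCapacity D.h e U).toReal / 2 = c`, and `0 ≤ c`.
[cite: BrayRPI2001, §6 (87) and Thm. 9] -/
theorem horizonCapacity_toReal_div_two_eq_of_harmonic_of_expansion' {α : ℝ} (hα : 0 < α)
    (hAF : e.IsMetricAsymptoticallyFlat D α) (hU : IsExteriorRegion e U) {φ₀ : X → ℝ}
    (hφ₀ : IsCapacityTestFn e U φ₀)
    (hΔ : ∀ x ∈ (U : Set X), D.metric.dalembertian φ₀ x = 0)
    (hfin : ∫⁻ x in (U : Set X), ENNReal.ofReal (gradNorm D.h φ₀ x ^ 2) ∂riemannianMeasure D.h < ⊤)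
    {c : ℝ}
    (hexp : (fun x : E3 ↦ ‖fderiv ℝ (fun y ↦ endValue e φ₀ y - (1 - c / ‖y‖)) x‖)
      =O[cobounded E3] fun x ↦ ‖x‖ ^ (-3 : ℝ)) :
    (horizonCapacity D.h e U).toReal / 2 = c ∧ 0 ≤ c := by
  haveI : (PseudoRiemannianMetric.ofRiemannian D.h).HasLeviCivita := ‹D.metric.HasLeviCivita›
  have hE := setIntegral_gradNorm_sq_eq_of_harmonic_of_expansion' D hα hAF hU hφ₀ hΔ hfin hexp
  have hreal := horizonCapacity_toReal_eq_of_harmonic' D.h hU hφ₀ hΔ hfin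
  rw [hE] at hreal
  have h2c : (horizonCapacity D.h e U).toReal = 2 * c := by
    rw [hreal]
    field_simp
    ring
  refine ⟨by rw [h2c]; ring, ?_⟩
  have h0 : 0 ≤ (horizonCapacity D.h e U).toReal := ENNReal.toReal_nonneg
  linarith

/-- **`½ ℰ(Σ, g) = c` under the hypotheses of `Bray2001_mass_ge_half_capacity`, without sign
hypotheses on the potential**: for time-symmetric data whose chosen end `e` is asymptotically
flat of order `1` (Bray's Def. 21) and a horizon `Σ ∈ 𝒮` with outside region `U`
(`IsOutsideOf e U f' ν'`), if the capacity potential `φ₀` of `Σ` — a test function, `h`-harmonic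
on `U`, of finite energy over `U`; no sign condition, `0 < φ₀ < 1` being automatic
(`IsCapacityTestFn.pos_of_harmonic`, `IsCapacityTestFn.lt_one_of_harmonic`), and unique
(`IsCapacityTestFn.eq_of_harmonic`) — has the expansion `φ₀ ∘ Φ = 1 − c/r + O₁(r⁻²)` of (87),
then the left-hand side of Thm. 9 is `(horizonCapacity D.h e U).toReal / 2 = c` (and `c ≥ 0`), so
that Thm. 9 for these data reads `m ≥ c`. [cite: BrayRPI2001, §6 (87) and Thm. 9] -/
theorem IsOutsideOf.horizonCapacity_toReal_div_two_eq' {S' : Type*} {f' : S' → X}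
    {ν' : NormalField (𝓡 3) f'} (hAF : e.IsAsymptoticallyFlat D 1) (hU : IsOutsideOf e U f' ν')
    {φ₀ : X → ℝ} (hφ₀ : IsCapacityTestFn e U φ₀)
    (hΔ : ∀ x ∈ (U : Set X), D.metric.dalembertian φ₀ x = 0)
    (hfin : ∫⁻ x in (U : Set X), ENNReal.ofReal (gradNorm D.h φ₀ x ^ 2) ∂riemannianMeasure D.h < ⊤)
    {c : ℝ}
    (hexp : (fun x : E3 ↦ ‖fderiv ℝ (fun y ↦ endValue e φ₀ y - (1 - c / ‖y‖)) x‖)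
      =O[cobounded E3] fun x ↦ ‖x‖ ^ (-3 : ℝ)) :
    (horizonCapacity D.h e U).toReal / 2 = c ∧ 0 ≤ c :=
  horizonCapacity_toReal_div_two_eq_of_harmonic_of_expansion' D one_pos
    hAF.isMetricAsymptoticallyFlat hU.isExteriorRegion hφ₀ hΔ hfin hexp

end Data

end Capacity

end Literature.Geometry.Lorentzian

end
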